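import Literature.LinearAlgebra.Matrix.RegularAdRangeSupCommutant   -- FILE A (★-pending): `exists_commute_add_commutator_eq_of_separable_charpoly`
import Mathlib.Analysis.Matrix.Normed
import Mathlib.Analysis.Calculus.InverseFunctionTheorem.FDeriv
import Mathlib.Analysis.Calculus.FDeriv.Mul
import Mathlib.Analysis.Calculus.FDeriv.Prod
import Mathlib.Analysis.Normed.Module.FiniteDimension
import HarnessLib

/-!
# The regular orbit chart over a complete valued field: near a regular semisimple `A`, every matrix is conjugate,
# by an element near `1`, to an element of the commutant `C(A)` near `A` (the orbit map `G × T → G` is a submersion)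

Topic `NumberTheory/Automorphic`; namespace `Literature.NumberTheory.Automorphic`. KERNEL mathematics only:
theorems, no definition, no named fact, no instance, no notation, no `sorry`.  Cell `pub/hodgecm-mathlib`, road
«D-N6s», LEAD F0P3a-plan (g8) WORD T7-65∕T7-70, brick «N6ns-chart» FILE B (FILE A = ★ `RegularAdRangeSupCommutant`):
the analytic input of «transfer away from the singular set» ((s3) of the «D-N6-ns» census) and of every «regular
orbital integrals are locally a product» statement — Harish-Chandra's submersion principle at a REGULAR SEMISIMPLE
point, over ANY complete nontrivially normed field `F` (archimedean or not; the consumers are the completions `L_w`).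

For `A ∈ M_n(F)` with separable characteristic polynomial (`F` perfect — characteristic zero in the applications) put
`C(A) := ker (ad A) = {Y ∣ AY = YA}` (a closed subspace) and `Ψ(X, Y) := (1 + X)(A + Y)(1 + X)⁻¹`
(`Ring.inverse`, so that `Ψ` is defined everywhere).  Then:

* §1 `hasStrictFDerivAt_conjOrbitMap` — `Ψ : M_n(F) × C(A) → M_n(F)` is STRICTLY differentiable at `(0, 0)` with
  derivative `(X, Y) ↦ XA − AX + Y` (Mathlib `HasStrictFDerivAt.mul'`, `hasStrictFDerivAt_ringInverse`; the matrix
  norms are Mathlib's scoped `Matrix.linftyOp*` structures, activated by `open scoped Matrix.Norms.Operator` — the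
  topology they carry is DEFINITIONALLY the tree's product topology, so all statements read in the usual topology); `surjective_conjOrbitMap_fderiv` — that derivative is ONTO
  (★ FILE A `exists_commute_add_commutator_eq_of_separable_charpoly`: `M_n = [A, M_n] + C(A)`).
* §2 **`map_conjOrbitMap_nhds_eq`** — `map Ψ (𝓝 (0, 0)) = 𝓝 A` (Mathlib's submersion theorem
  `HasStrictFDerivAt.map_nhds_eq_of_surj`): the image of every neighbourhood of `(0, 0)` is a neighbourhood of `A`.
* §3 the consumers' readings: **`setOf_conj_mem_nhds_of_separable_charpoly`** — for every neighbourhood `U` of `0`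
  in `C(A)` and `V` of `0` in `M_n(F)`, `{(1 + X)(A + Y)(1 + X)⁻¹ ∣ X ∈ V, Y ∈ U}` is a neighbourhood of `A`;
  **`setOf_units_conj_mem_nhds_of_separable_charpoly`** — for every neighbourhood `U` of `0` in `C(A)`,
  `{g (A + Y) g⁻¹ ∣ g ∈ M_n(F)ˣ, Y ∈ U}` is a neighbourhood of `A` (units are open: `V := {X ∣ 1 + X ∈ M_nˣ}`).
  In words: regular semisimple elements conjugate into any given neighbourhood of `A` inside the commutative algebra
  `C(A) = F[A]` fill a neighbourhood of `A` — the openness half of the regular orbit chart.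

## References

* [HarishChandra1970] Harish-Chandra (notes by G. van Dijk), *Harmonic Analysis on Reductive `p`-adic Groups*,
  LNM 162 (1970), Part I §3 (the submersion `G × T′ → G`, `(x, t) ↦ x t x⁻¹`, at regular points).
* [Borel1991] A. Borel, *Linear Algebraic Groups*, 2nd ed. (1991), I.4 (4.2, 4.4) (semisimplicity of `ad`).
* [Rogawski1990] J. D. Rogawski, *Automorphic Representations of Unitary Groups in Three Variables* (1990), §4.3 p. 43
  (orbital integrals on the regular set).
-/

set_option autoImplicit false

noncomputable section

open Filter Topology
open scoped Matrix.Norms.Operator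

namespace Literature.NumberTheory.Automorphic

variable {F : Type*} [NontriviallyNormedField F] [CompleteSpace F] {n : Type*} [Fintype n] [DecidableEq n]

/-! ### 1. The orbit map `Ψ(X, Y) = (1 + X)(A + Y)(1 + X)⁻¹` is a submersion at `(0, 0)` -/

/-- **`Ψ` is strictly differentiable at `(0, 0)` with derivative `(X, Y) ↦ XA − AX + Y`** — stated as: there is a
continuous linear `D` with `D (X, Y) = X A − A X + Y` which is a strict derivative of
`(X, Y) ↦ (1 + X)(A + Y)(1 + X)⁻¹` at `(0, 0)` (product rule and the strict derivative `X ↦ −X` of `Ring.inverse` at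
`1`; the normed structure is Mathlib's scoped `L^∞`-operator norm, whose topology is definitionally the product one). [folklore] -/
private theorem hasStrictFDerivAt_conjOrbitMap (A : Matrix n n F) (C : Submodule F (Matrix n n F)) :
    ∃ D : (Matrix n n F × C) →L[F] Matrix n n F,
      (∀ X : Matrix n n F, ∀ Y : C, D (X, Y) = X * A - A * X + (Y : Matrix n n F)) ∧
      HasStrictFDerivAt (fun p : Matrix n n F × C => (1 + p.1) * (A + (p.2 : Matrix n n F)) * Ring.inverse (1 + p.1))
        D 0 := by
  haveI : CompleteSpace (Matrix n n F) := FiniteDimensional.complete F (Matrix n n F)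
  have h1 : HasStrictFDerivAt (fun p : Matrix n n F × C => (1 : Matrix n n F) + p.1)
      (ContinuousLinearMap.fst F (Matrix n n F) C) 0 :=
    (ContinuousLinearMap.fst F (Matrix n n F) C).hasStrictFDerivAt.const_add 1
  have h2 : HasStrictFDerivAt (fun p : Matrix n n F × C => A + (p.2 : Matrix n n F))
      ((C.subtypeL).comp (ContinuousLinearMap.snd F (Matrix n n F) C)) 0 :=
    ((C.subtypeL).comp (ContinuousLinearMap.snd F (Matrix n n F) C)).hasStrictFDerivAt.const_add A
  have hpt : (fun p : Matrix n n F × C => (1 : Matrix n n F) + p.1) 0 = ((1 : (Matrix n n F)ˣ) : Matrix n n F) := by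
    simp
  have hg : HasStrictFDerivAt (Ring.inverse : Matrix n n F → Matrix n n F)
      (-ContinuousLinearMap.mulLeftRight F (Matrix n n F) ((1 : (Matrix n n F)ˣ)⁻¹ : (Matrix n n F)ˣ)
        ((1 : (Matrix n n F)ˣ)⁻¹ : (Matrix n n F)ˣ))
      ((fun p : Matrix n n F × C => (1 : Matrix n n F) + p.1) 0) := by
    rw [hpt]; exact hasStrictFDerivAt_ringInverse (1 : (Matrix n n F)ˣ)
  have h3 := HasStrictFDerivAt.comp (f := fun p : Matrix n n F × C => (1 : Matrix n n F) + p.1) 0 hg h1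
  have hΨ := (h1.mul' h2).mul' h3
  refine ⟨_, fun X Y => ?_, hΨ⟩
  -- evaluate the product-rule derivative at `(X, Y)` (definitional unfolding, then clean-up)
  refine (?_ : _ = ((1 : Matrix n n F) + (0 : Matrix n n F × C).1) * (A + ((0 : Matrix n n F × C).2 : Matrix n n F)) *
      (-((((1 : (Matrix n n F)ˣ)⁻¹ : (Matrix n n F)ˣ) : Matrix n n F) * X *
        (((1 : (Matrix n n F)ˣ)⁻¹ : (Matrix n n F)ˣ) : Matrix n n F))) +
      (((1 : Matrix n n F) + (0 : Matrix n n F × C).1) * (Y : Matrix n n F) +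
          X * (A + ((0 : Matrix n n F × C).2 : Matrix n n F))) *
        Ring.inverse ((1 : Matrix n n F) + (0 : Matrix n n F × C).1)).trans ?_
  · rfl
  · simp only [Prod.fst_zero, Prod.snd_zero, add_zero, ZeroMemClass.coe_zero, inv_one, Units.val_one,
      Ring.inverse_one, one_mul, mul_one, mul_neg]
    abel

/-! ### 2. The submersion theorem at `(0, 0)` -/

/-- **`map Ψ (𝓝 0) = 𝓝 A`**: for `A` with separable characteristic polynomial over a perfect complete valued field,
the orbit map `(X, Y) ↦ (1 + X)(A + Y)(1 + X)⁻¹` on `M_n(F) × C(A)` (`C(A) = ker (L_A − R_A)` the commutant) maps the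
neighbourhood filter of `(0, 0)` ONTO the neighbourhood filter of `A` — its strict derivative `(X, Y) ↦ XA − AX + Y`
is onto by ★ `exists_commute_add_commutator_eq_of_separable_charpoly` (`M_n = [A, M_n] + C(A)`), and Mathlib's
`HasStrictFDerivAt.map_nhds_eq_of_surj` applies. [cite: HarishChandra1970, Part I §3] [cite: Borel1991, I.4 (4.2, 4.4)] -/
theorem map_conjOrbitMap_nhds_eq [PerfectField F] (A : Matrix n n F) (hA : A.charpoly.Separable) :
    Filter.map (fun p : Matrix n n F × ↥(LinearMap.ker (LinearMap.mulLeft F A - LinearMap.mulRight F A :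
        Module.End F (Matrix n n F))) =>
      (1 + p.1) * (A + (p.2 : Matrix n n F)) * Ring.inverse (1 + p.1)) (𝓝 0) = 𝓝 A := by
  haveI : CompleteSpace (Matrix n n F) := FiniteDimensional.complete F (Matrix n n F)
  haveI : CompleteSpace ↥(LinearMap.ker (LinearMap.mulLeft F A - LinearMap.mulRight F A :
      Module.End F (Matrix n n F))) := FiniteDimensional.complete F _
  obtain ⟨D, hD, hΨ⟩ := hasStrictFDerivAt_conjOrbitMap A
    (LinearMap.ker (LinearMap.mulLeft F A - LinearMap.mulRight F A : Module.End F (Matrix n n F)))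
  have hrange : D.range = ⊤ := by
    refine LinearMap.range_eq_top.mpr fun Z => ?_
    obtain ⟨X₀, Y₀, hcomm, hZ⟩ :=
      Literature.LinearAlgebra.Matrix.exists_commute_add_commutator_eq_of_separable_charpoly A hA Z
    have hY₀ : Y₀ ∈ LinearMap.ker (LinearMap.mulLeft F A - LinearMap.mulRight F A : Module.End F (Matrix n n F)) := by
      rw [LinearMap.mem_ker, LinearMap.sub_apply, LinearMap.mulLeft_apply, LinearMap.mulRight_apply, ← hcomm, sub_self]
    refine ⟨(-X₀, ⟨Y₀, hY₀⟩), ?_⟩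
    rw [ContinuousLinearMap.coe_coe, hD, hZ]
    noncomm_ring
  have key := hΨ.map_nhds_eq_of_surj hrange
  have h0 : ((1 : Matrix n n F) + (0 : Matrix n n F × ↥(LinearMap.ker (LinearMap.mulLeft F A - LinearMap.mulRight F A :
        Module.End F (Matrix n n F)))).1) *
      (A + ((0 : Matrix n n F × ↥(LinearMap.ker (LinearMap.mulLeft F A - LinearMap.mulRight F A :
        Module.End F (Matrix n n F)))).2 : Matrix n n F)) *
      Ring.inverse ((1 : Matrix n n F) + (0 : Matrix n n F × ↥(LinearMap.ker (LinearMap.mulLeft F A -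
        LinearMap.mulRight F A : Module.End F (Matrix n n F)))).1) = A := by
    simp only [Prod.fst_zero, Prod.snd_zero, add_zero, ZeroMemClass.coe_zero, Ring.inverse_one, mul_one, one_mul]
  rw [h0] at key
  exact key

/-! ### 3. The consumers' readings: conjugates of `C(A)`-near-`A` elements fill a neighbourhood of `A` -/

/-- **For every neighbourhood `U` of `0` in `C(A)` and `V` of `0` in `M_n(F)`, the conjugates
`(1 + X)(A + Y)(1 + X)⁻¹`, `X ∈ V`, `Y ∈ U`, form a NEIGHBOURHOOD of `A`** (`A` with separable characteristic
polynomial, `F` a perfect complete valued field). [cite: HarishChandra1970, Part I §3] -/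
theorem setOf_conj_mem_nhds_of_separable_charpoly [PerfectField F] (A : Matrix n n F) (hA : A.charpoly.Separable)
    (U : Set ↥(LinearMap.ker (LinearMap.mulLeft F A - LinearMap.mulRight F A : Module.End F (Matrix n n F))))
    (hU : U ∈ 𝓝 0) (V : Set (Matrix n n F)) (hV : V ∈ 𝓝 0) :
    {W : Matrix n n F | ∃ X ∈ V, ∃ Y ∈ U, W = (1 + X) * (A + (Y : Matrix n n F)) * Ring.inverse (1 + X)} ∈ 𝓝 A := by
  have hVU : V ×ˢ U ∈ 𝓝 (0 : Matrix n n F × ↥(LinearMap.ker (LinearMap.mulLeft F A - LinearMap.mulRight F A :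
      Module.End F (Matrix n n F)))) := prod_mem_nhds hV hU
  have hmem := Filter.image_mem_map
    (m := fun p : Matrix n n F × ↥(LinearMap.ker (LinearMap.mulLeft F A - LinearMap.mulRight F A :
        Module.End F (Matrix n n F))) => (1 + p.1) * (A + (p.2 : Matrix n n F)) * Ring.inverse (1 + p.1))
    hVU
  rw [map_conjOrbitMap_nhds_eq A hA] at hmem
  refine Filter.mem_of_superset hmem ?_
  rintro W ⟨⟨X, Y⟩, ⟨hX, hY⟩, rfl⟩
  exact ⟨X, hX, Y, hY, rfl⟩

/-- **For every neighbourhood `U` of `0` in `C(A)`, the conjugates `g (A + Y) g⁻¹`, `g ∈ M_n(F)ˣ`, `Y ∈ U`, form a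
NEIGHBOURHOOD of `A`** — the openness half of the regular orbit chart: elements near a regular semisimple `A` are
conjugate to elements of the commutative algebra `C(A) = F[A]` near `A` (take `V := {X ∣ 1 + X ∈ M_n(F)ˣ}`, open since
units are open in a complete normed ring). [cite: HarishChandra1970, Part I §3] [cite: Rogawski1990, §4.3 p. 43] -/
theorem setOf_units_conj_mem_nhds_of_separable_charpoly [PerfectField F] (A : Matrix n n F)
    (hA : A.charpoly.Separable)
    (U : Set ↥(LinearMap.ker (LinearMap.mulLeft F A - LinearMap.mulRight F A : Module.End F (Matrix n n F))))
    (hU : U ∈ 𝓝 0) :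
    {W : Matrix n n F | ∃ g : (Matrix n n F)ˣ, ∃ Y ∈ U,
      W = (g : Matrix n n F) * (A + (Y : Matrix n n F)) * ((g⁻¹ : (Matrix n n F)ˣ) : Matrix n n F)} ∈ 𝓝 A := by
  haveI : CompleteSpace (Matrix n n F) := FiniteDimensional.complete F (Matrix n n F)
  have hV : {X : Matrix n n F | IsUnit (1 + X)} ∈ 𝓝 (0 : Matrix n n F) := by
    have ho : IsOpen {X : Matrix n n F | IsUnit (1 + X)} :=
      Units.isOpen.preimage (continuous_const.add continuous_id)
    exact ho.mem_nhds (by simp)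
  refine Filter.mem_of_superset (setOf_conj_mem_nhds_of_separable_charpoly A hA U hU _ hV) ?_
  rintro W ⟨X, hX, Y, hY, rfl⟩
  obtain ⟨g, hg⟩ := hX
  refine ⟨g, Y, hY, ?_⟩
  rw [← hg, Ring.inverse_unit]

end Literature.NumberTheory.Automorphic

end
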